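import Summits.QuantumAdvantage.QuantumAdvantage.Theorems.LinnikCubicClassGroupsDegreeOnePrimesEscapeConjInvariantPNTCongr
import HarnessLib

/-!
# Conjugation-invariant Chebotarev PNT: Siegel-free consequences

Topic `Summits/QuantumAdvantage/QuantumAdvantage/Theorems`, cell B2b-1 (linnik-cubic), PART A (gen 14);
helper toward the crux `DegreeOnePrimesEscape` (stmt-QuantumAdvantage-11543) of route
`LinnikCubicClassGroups`.  HONEST FRAMING: the value of this file is a THEOREM (kernel-checked, GRH-free,
Siegel-free, no hypothesis) — NOT summit progress.

Corollaries of `conjInvariant_PNT_pi_congr` (`S ⊆ Gal(N/ℚ)` conjugation-invariant and nonempty, `P` any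
prime predicate agreeing with "Frob_p ∈ S" at `p ∤ d_N`, `δ_S = |S|/|G|`, `x ≥ |d_N|^L`):

* `conjInvariant_pi_twoSided_of_forall_index_ne_two` — if `G` has no subgroup of index two (no room for
  an exceptional quadratic subfield): `|π_P(x) − δ_S Li(x)| ≤ ε δ_S Li(x)`;
* `conjInvariant_pi_ge_of_forall_index_two` — if `S` avoids every index-two subgroup (so the exceptional
  character is `−1` on all of `S` and the Siegel term can only help): `π_P(x) ≥ (1 − ε) δ_S Li(x)`.
[cite: LagariasMontgomeryOdlyzko1979, Theorem 1.1] [cite: Stark1974, Theorem 3]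
-/

noncomputable section

open scoped NumberField nonZeroDivisors
open Finset Real Ideal NumberField
open Literature.NumberTheory.NumberFields Literature.NumberTheory.LFunctions
  Literature.NumberTheory.LFunctions.NumberField

namespace Summit.QuantumAdvantage.QuantumAdvantage.Theorems.DegreeOnePrimesEscape

set_option maxHeartbeats 4000000 in
/-- **No subgroup of index two ⟹ `|π_P(x) − δ_S Li(x)| ≤ ε δ_S Li(x)`** for every nonempty
conjugation-invariant `S`, every agreeing predicate `P` and every `x ≥ |d_N|^L`.  Unconditional.
[cite: LagariasMontgomeryOdlyzko1979, Theorem 1.1] [cite: Stark1974, Theorem 3] -/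
theorem conjInvariant_pi_twoSided_of_forall_index_ne_two (n : ℕ) (hn : 1 < n) {ε : ℝ} (hε : 0 < ε)
    (hε1 : ε ≤ 1) :
    ∃ L : ℝ, 0 < L ∧ ∀ (N : Type) [Field N] [NumberField N] [IsGalois ℚ N],
      Module.finrank ℚ N = n → (∀ K : Subgroup (N ≃ₐ[ℚ] N), K.index ≠ 2) →
      ∀ S : Set (N ≃ₐ[ℚ] N), (∀ g h : N ≃ₐ[ℚ] N, g ∈ S → h * g * h⁻¹ ∈ S) → S.Nonempty →
        ∀ (P : ℕ → Prop) [DecidablePred P],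
          (∀ p : ℕ, p.Prime → ¬ ((p : ℤ) ∣ NumberField.discr N) →
            (P p ↔ ∃ (Q : Ideal (𝓞 N)) (_ : Q.IsMaximal) (_ : Q.LiesOver (span {(p : ℤ)}))
              (φ : N ≃ₐ[ℚ] N), IsArithFrobAt ℤ φ Q ∧ Q.inertia (N ≃ₐ[ℚ] N) = ⊥ ∧ φ ∈ S)) →
          ∀ x : ℝ, ((NumberField.discr N).natAbs : ℝ) ^ L ≤ x →
            |((((Nat.primesLE ⌊x⌋₊).filter P).card : ℕ) : ℝ) -
              (Nat.card S : ℝ) / Nat.card (N ≃ₐ[ℚ] N) * offsetLogIntegral x| ≤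
              ε * ((Nat.card S : ℝ) / Nat.card (N ≃ₐ[ℚ] N) * offsetLogIntegral x) := by
  obtain ⟨L, c, hL, -, -, h⟩ := conjInvariant_PNT_pi_congr n hn hε hε1
  refine ⟨L, hL, fun N _ _ _ hN hG S hS hSne P _ hP x hx => ?_⟩
  obtain ⟨θ, β₁, K₁, hθ, -, -, -, h1, -, hmain⟩ := h N hN
  rcases hθ with hθ0 | hθ1
  · subst hθ0
    have hm := hmain S hS hSne P hP x hx
    have e : ((Nat.card S : ℝ) * offsetLogIntegral x -
        0 * ((Nat.card {g : N ≃ₐ[ℚ] N // g ∈ S ∧ g ∈ K₁} : ℝ) -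
          Nat.card {g : N ≃ₐ[ℚ] N // g ∈ S ∧ g ∉ K₁}) * offsetLogIntegral (x ^ β₁)) /
        Nat.card (N ≃ₐ[ℚ] N) = (Nat.card S : ℝ) / Nat.card (N ≃ₐ[ℚ] N) * offsetLogIntegral x := by
      ring
    rw [e] at hm
    exact hm
  · exact absurd (h1 hθ1).2.1 (hG K₁)

set_option maxHeartbeats 4000000 in
/-- **`S` off every subgroup of index two ⟹ `π_P(x) ≥ (1 − ε) δ_S Li(x)`** for every `x ≥ |d_N|^L`
(the exceptional character equals `−1` on `S`, so the Siegel term is nonnegative).  Unconditional.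
[cite: LagariasMontgomeryOdlyzko1979, Theorem 1.1] -/
theorem conjInvariant_pi_ge_of_forall_index_two (n : ℕ) (hn : 1 < n) {ε : ℝ} (hε : 0 < ε) (hε1 : ε ≤ 1) :
    ∃ L : ℝ, 0 < L ∧ ∀ (N : Type) [Field N] [NumberField N] [IsGalois ℚ N],
      Module.finrank ℚ N = n →
      ∀ S : Set (N ≃ₐ[ℚ] N), (∀ g h : N ≃ₐ[ℚ] N, g ∈ S → h * g * h⁻¹ ∈ S) → S.Nonempty →
        (∀ g ∈ S, ∀ K : Subgroup (N ≃ₐ[ℚ] N), K.index = 2 → g ∉ K) →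
        ∀ (P : ℕ → Prop) [DecidablePred P],
          (∀ p : ℕ, p.Prime → ¬ ((p : ℤ) ∣ NumberField.discr N) →
            (P p ↔ ∃ (Q : Ideal (𝓞 N)) (_ : Q.IsMaximal) (_ : Q.LiesOver (span {(p : ℤ)}))
              (φ : N ≃ₐ[ℚ] N), IsArithFrobAt ℤ φ Q ∧ Q.inertia (N ≃ₐ[ℚ] N) = ⊥ ∧ φ ∈ S)) →
          ∀ x : ℝ, ((NumberField.discr N).natAbs : ℝ) ^ L ≤ x →
            (1 - ε) * ((Nat.card S : ℝ) / Nat.card (N ≃ₐ[ℚ] N) * offsetLogIntegral x) ≤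
              ((((Nat.primesLE ⌊x⌋₊).filter P).card : ℕ) : ℝ) := by
  obtain ⟨L₀, c, hL₀, hc, hc4, h⟩ := conjInvariant_PNT_pi_congr n hn hε hε1
  set L : ℝ := max L₀ 1 with hL
  refine ⟨L, lt_of_lt_of_le hL₀ (le_max_left _ _), fun N _ _ _ hN S hS hSne hσ P _ hP x hx => ?_⟩
  obtain ⟨θ, β₁, K₁, hθ, -, hβ₁c, hβ₁1, h1, -, hmain⟩ := h N hN
  have hN1 : 1 < Module.finrank ℚ N := by rw [hN]; exact hn
  set d : ℝ := ((NumberField.discr N).natAbs : ℝ) with hd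
  have hd3 : (3 : ℝ) ≤ d := three_le_natAbs_discr_real N hN1
  have hd1 : (1 : ℝ) ≤ d := by linarith
  have hx₀ : d ^ L₀ ≤ x := (Real.rpow_le_rpow_of_exponent_le hd1 (le_max_left _ _)).trans hx
  have hx3 : (3 : ℝ) ≤ x := by
    have := (Real.rpow_le_rpow_of_exponent_le hd1 (le_max_right L₀ 1)).trans hx
    rw [Real.rpow_one] at this; linarith
  have hx1 : 1 < x := by linarith
  have hG0 : (0 : ℝ) ≤ Nat.card (N ≃ₐ[ℚ] N) := Nat.cast_nonneg _
  have hδ0 : 0 ≤ (Nat.card S : ℝ) / Nat.card (N ≃ₐ[ℚ] N) := div_nonneg (Nat.cast_nonneg _) hG0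
  have hLi0x : 0 ≤ offsetLogIntegral x := by
    rw [offsetLogIntegral]
    exact intervalIntegral.integral_nonneg (by linarith) fun t ht => by
      have : 1 < t := by linarith [ht.1]
      exact inv_nonneg.mpr (Real.log_nonneg this.le)
  have hm := hmain S hS hSne P hP x hx₀
  have h1ε : 0 ≤ 1 - ε := by linarith
  rcases hθ with hθ0 | hθ1
  · subst hθ0
    have e : ((Nat.card S : ℝ) * offsetLogIntegral x -
        0 * ((Nat.card {g : N ≃ₐ[ℚ] N // g ∈ S ∧ g ∈ K₁} : ℝ) -
          Nat.card {g : N ≃ₐ[ℚ] N // g ∈ S ∧ g ∉ K₁}) * offsetLogIntegral (x ^ β₁)) /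
        Nat.card (N ≃ₐ[ℚ] N) = (Nat.card S : ℝ) / Nat.card (N ≃ₐ[ℚ] N) * offsetLogIntegral x := by
      ring
    rw [e] at hm
    have h2 := (abs_le.mp hm).1
    nlinarith [mul_nonneg hδ0 hLi0x]
  · obtain ⟨-, hK₁, -⟩ := h1 hθ1
    subst hθ1
    -- `S ∩ K₁ = ∅`
    have hempty : Nat.card {g : N ≃ₐ[ℚ] N // g ∈ S ∧ g ∈ K₁} = 0 := by
      haveI : IsEmpty {g : N ≃ₐ[ℚ] N // g ∈ S ∧ g ∈ K₁} :=
        ⟨fun g => hσ g.1 g.2.1 K₁ hK₁ g.2.2⟩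
      exact Nat.card_of_isEmpty
    have hfull : Nat.card {g : N ≃ₐ[ℚ] N // g ∈ S ∧ g ∉ K₁} = Nat.card S := by
      refine Nat.card_congr (Equiv.subtypeEquivRight fun g => ?_)
      exact ⟨fun hg => hg.1, fun hg => ⟨hg, hσ g hg K₁ hK₁⟩⟩
    rw [hempty, hfull] at hm
    -- `Li(x^{β₁}) ≥ 0`
    have hβ34 : 3 / 4 ≤ β₁ := three_quarters_le_of_window hc hc4 hd3 hβ₁c
    have hxβ : (2 : ℝ) ≤ x ^ β₁ := by
      have h9 : (3 : ℝ) ^ ((3 : ℝ) / 4) ≤ x ^ β₁ :=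
        (Real.rpow_le_rpow (by norm_num) hx3 (by norm_num)).trans
          (Real.rpow_le_rpow_of_exponent_le hx1.le hβ34)
      have h8 : (2 : ℝ) ≤ (3 : ℝ) ^ ((3 : ℝ) / 4) := by
        have h16 : ((2 : ℝ) ^ (4 : ℕ) : ℝ) ≤ (3 : ℝ) ^ (3 : ℕ) := by norm_num
        have : ((2 : ℝ) ^ (4 : ℝ)) ^ ((1 : ℝ) / 4) ≤ ((3 : ℝ) ^ (3 : ℝ)) ^ ((1 : ℝ) / 4) := by
          apply Real.rpow_le_rpow (by positivity) _ (by norm_num)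
          rw [show (4 : ℝ) = ((4 : ℕ) : ℝ) by norm_num, show (3 : ℝ) = ((3 : ℕ) : ℝ) by norm_num,
            Real.rpow_natCast, Real.rpow_natCast]
          exact_mod_cast h16
        rw [← Real.rpow_mul (by norm_num), ← Real.rpow_mul (by norm_num)] at this
        norm_num at this
        exact this
      linarith
    have hLi0 : 0 ≤ offsetLogIntegral (x ^ β₁) := by
      rw [offsetLogIntegral]
      exact intervalIntegral.integral_nonneg hxβ fun t ht => by
        have : 1 < t := by linarith [ht.1]
        exact inv_nonneg.mpr (Real.log_nonneg this.le)
    have h2 := (abs_le.mp hm).1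
    have e : ((Nat.card S : ℝ) * offsetLogIntegral x -
        1 * (((0 : ℕ) : ℝ) - Nat.card S) * offsetLogIntegral (x ^ β₁)) / Nat.card (N ≃ₐ[ℚ] N) =
        (Nat.card S : ℝ) / Nat.card (N ≃ₐ[ℚ] N) * offsetLogIntegral x +
        (Nat.card S : ℝ) / Nat.card (N ≃ₐ[ℚ] N) * offsetLogIntegral (x ^ β₁) := by
      push_cast; ring
    rw [e] at h2
    nlinarith [mul_nonneg hδ0 hLi0, mul_nonneg h1ε (mul_nonneg hδ0 hLi0)]

end Summit.QuantumAdvantage.QuantumAdvantage.Theorems.DegreeOnePrimesEscape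

end
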